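import Literature.Probability.RandomPlanarGeometry.SLESameSideLaw
import Literature.Probability.RandomPlanarGeometry.CardyFunctionIncBeta
import Literature.Probability.RandomPlanarGeometry.RohdeSchrammCor35Proofs
import HarnessLib

/-!
# SLE₆ side-arc touch law, part 1: the half-plane touch law at `κ = 6`

Helper file for the registered stub `stub_sleSideTouch` (statement `SleSideTouch`) of the line
`collar-touch-sandwich` of crux `SLESixFamiliesGiveCardy` (stmt-CriticalPhenomena-9654).

For chordal SLE₆ in `(ℍ; 0, ∞)` and a compact real segment `[y, x]`, `0 < y < x`, the trace
touches `[y, x]` with probability `1 - F(y/x) = F((x-y)/x)`, `F` Cardy's function; the same holds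
for the mirror segment `[-x, -y]`. Ingredients (all proved in the tree):

* Rohde–Schramm's sharp same-side law (`measureReal_swallowingTime_eq_sameSide`, Lemma 6.6):
  `P[T_y = T_x] = (h(z₀) - h(1))/(h(∞) - h(1))`, `z₀ = x/(x-y)`, `h = sameSideH (2/κ)`;
* its hypergeometric form (`sameSide_hittingProb_eq_rohdeSchramm613`, eq. (6.13)) at `a = 1/3`,
  which is Cardy's function of `y/x` by Legendre's duplication (`Gamma_two_mul_div_eq`) and
  `Γ(4/3) = Γ(1/3)/3` (`measureReal_swallowingTime_eq_six`);
* `[y, x) ∩ γ = ∅ ↔ T_y = T_x` on curve-generated chains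
  (`Loewner.IsGeneratedByCurve.forall_notMem_range_iff_swallowingTime_eq`), the trace theorem
  `hasSLETrace_of_ne_eight_holds`, and a fixed real point is a.s. not visited
  (`ae_ofReal_notMem_range_sleTrace`);
* the reflection `W ↦ -W` of the driving function (`identDistrib_sleDriving_neg`,
  `swallowTogetherEvent`, `Loewner.IsGeneratedByCurve.neg_conj`, `swallowingTime_neg_ofReal`) for the
  mirror segment.

Main results: `measureReal_exists_mem_Icc_mem_range_sleTrace_six` (positive side),
`measureReal_exists_mem_Icc_neg_mem_range_sleTrace_six` (negative side) and the registered helper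
`sleSix_touch_uIcc` (both sides, segment `uIcc u v` with `u, v` of the same sign).
-/

noncomputable section

open MeasureTheory ProbabilityTheory Filter Set Topology
open scoped NNReal ENNReal Real ComplexConjugate

namespace Summit.CriticalPhenomena.CardyFormulaZ2.Cruxes.SLESixFamiliesGiveCardy.CollarTouchSandwich

open Literature.Probability.RandomPlanarGeometry Loewner Literature.Probability.Process

/-! ### `P[T_y = T_x] = F(y/x)` at `κ = 6` -/

/-- **The same-side two-point law of SLE₆ is Cardy's function**: for `0 < y < x`,
`P[T_y = T_x] = F(y/x)` for chordal SLE₆ in `ℍ` (Rohde–Schramm (2005), Lemma 6.6 / eq. (6.13) at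
`κ = 6`, `a = 1/3`; the constant `4^{1/3} √π/(Γ(4/3)Γ(1/6)) = 3Γ(2/3)/Γ(1/3)²` is Legendre's
duplication formula at `1/6`). -/
theorem measureReal_swallowingTime_eq_six {x y : ℝ} (hy : 0 < y) (hyx : y < x) :
    preWienerMeasure.real
        {ω | swallowingTime (sleDriving 6 ω) y = swallowingTime (sleDriving 6 ω) x} =
      cardyFunction (y / x) := by
  rw [measureReal_swallowingTime_eq_sameSide (κ := 6) (by norm_num) (by norm_num) hy hyx]
  have h26 : (2 : ℝ) / ((6 : ℝ≥0) : ℝ) = 1 / 3 := by norm_num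
  rw [h26]
  set s : ℝ := x / y with hs_def
  have hs : 1 < s := (one_lt_div hy).2 hyx
  have hs0 : 0 < s := one_pos.trans hs
  have hz : x / (x - y) = s / (s - 1) := by
    rw [hs_def]
    field_simp
  have hyx' : y / x = 1 / s := by rw [hs_def]; field_simp
  rw [hz, sameSide_hittingProb_eq_rohdeSchramm613 (a := 1 / 3) (by norm_num) (by norm_num) hs,
    hyx', cardyFunction]
  have hdup := Gamma_two_mul_div_eq (a := (1 / 3 : ℝ)) (by norm_num)
  have hpow : s ^ (-(1 / 3 : ℝ)) = (1 / s) ^ (1 / 3 : ℝ) := by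
    rw [Real.rpow_neg hs0.le, one_div s, Real.inv_rpow hs0.le]
  norm_num at hdup hpow ⊢
  have hG : Real.Gamma (4 / 3) = 1 / 3 * Real.Gamma (1 / 3) := by
    rw [show (4 / 3 : ℝ) = 1 / 3 + 1 by norm_num, Real.Gamma_add_one (by norm_num)]
  have h1 : Real.Gamma (1 / 3 : ℝ) ≠ 0 := (Real.Gamma_pos_of_pos (by norm_num)).ne'
  have h3 : Real.Gamma (1 / 6 : ℝ) ≠ 0 := (Real.Gamma_pos_of_pos (by norm_num)).ne'
  rw [hpow, hG]
  rw [div_eq_div_iff h1 h3] at hdup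
  set F := ₂F₁ (1 / 3 : ℝ) (2 / 3 : ℝ) (4 / 3 : ℝ) s⁻¹
  set P := s⁻¹ ^ (1 / 3 : ℝ)
  field_simp
  linear_combination (-F * P) * hdup

/-- **Reflection**: `P[T_{-y} = T_{-x}] = P[T_y = T_x]` for `0 < y`, `0 < x` (the driving
functions `W` and `-W` have the same law, `identDistrib_sleDriving_neg`, and
`T_{-x}(W) = T_x(-W)`, `swallowingTime_neg_ofReal`; the event is read through the measurable
path-space event `swallowTogetherEvent`). -/
theorem measureReal_swallowingTime_neg_eq (κ : ℝ≥0) {x y : ℝ} (hx : 0 < x) (hy : 0 < y) :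
    preWienerMeasure.real {ω | swallowingTime (sleDriving κ ω) ((-y : ℝ) : ℂ) =
        swallowingTime (sleDriving κ ω) ((-x : ℝ) : ℂ)} =
      preWienerMeasure.real
        {ω | swallowingTime (sleDriving κ ω) y = swallowingTime (sleDriving κ ω) x} := by
  have hmeas := measurableSet_swallowTogetherEvent (x := x) (y := y) hx hy
  have hlaw := (identDistrib_sleDriving_neg κ).measure_mem_eq hmeas
  have hpos : {ω : ℝ≥0 → ℝ | swallowingTime (sleDriving κ ω) y =
      swallowingTime (sleDriving κ ω) x} =
      (fun ω t ↦ sleDriving κ ω t) ⁻¹' swallowTogetherEvent x y := by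
    ext ω
    exact (mem_swallowTogetherEvent_iff (continuous_sleDriving κ ω) (sleDriving_zero κ ω) x y).symm
  have hneg : {ω : ℝ≥0 → ℝ | swallowingTime (sleDriving κ ω) ((-y : ℝ) : ℂ) =
      swallowingTime (sleDriving κ ω) ((-x : ℝ) : ℂ)} =
      (fun ω t ↦ -sleDriving κ ω t) ⁻¹' swallowTogetherEvent x y := by
    ext ω
    have e1 : swallowingTime (fun t ↦ -sleDriving κ ω t) (y : ℂ) =
        swallowingTime (sleDriving κ ω) ((-y : ℝ) : ℂ) := by
      simpa using swallowingTime_neg_ofReal (sleDriving κ ω) (-y)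
    have e2 : swallowingTime (fun t ↦ -sleDriving κ ω t) (x : ℂ) =
        swallowingTime (sleDriving κ ω) ((-x : ℝ) : ℂ) := by
      simpa using swallowingTime_neg_ofReal (sleDriving κ ω) (-x)
    rw [mem_preimage, mem_swallowTogetherEvent_iff (w := fun t ↦ -sleDriving κ ω t)
      (continuous_sleDriving κ ω).neg (by simp [sleDriving_zero]) x y, e1, e2]
    rfl
  rw [measureReal_def, measureReal_def, hneg, hpos, hlaw]

/-! ### The touch law for a positive segment -/

/-- **Deterministic identification** (curve-generated chain, continuous driving function from `0`,
`0 < y ≤ x`, right end point `x` not visited): some real point of `[y, x]` is on the curve iff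
`T_y ≠ T_x`. -/
theorem exists_mem_Icc_mem_range_iff {W : ℝ≥0 → ℝ} {γ : ℝ≥0 → ℂ} (hγ : IsGeneratedByCurve W γ)
    (hW : Continuous W) (hW0 : W 0 = 0) {x y : ℝ} (hy : 0 < y) (hyx : y ≤ x)
    (hx : (x : ℂ) ∉ range γ) :
    (∃ r : ℝ, r ∈ Icc y x ∧ (r : ℂ) ∈ range γ) ↔ swallowingTime W y ≠ swallowingTime W x := by
  rw [Ne, ← hγ.forall_notMem_range_iff_swallowingTime_eq hW hW0 hy hyx]
  constructor
  · rintro ⟨r, hr, hmem⟩ hall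
    rcases hr.2.lt_or_eq with hlt | heq
    · exact hall r hr.1 hlt hmem
    · exact hx (heq ▸ hmem)
  · intro h
    by_contra hne
    push Not at hne
    exact h fun r hyr hrx ↦ hne r ⟨hyr, hrx.le⟩

/-- **The SLE₆ touch law for a positive segment**: for `0 < y < x`, the SLE₆ trace meets the real
segment `[y, x]` with probability `1 - F(y/x)` (a.s. the event is `{T_y ≠ T_x}`: Rohde–Schramm's
trace theorem, the right end point is a.s. not visited, `exists_mem_Icc_mem_range_iff`; then
`measureReal_swallowingTime_eq_six`). -/
theorem measureReal_exists_mem_Icc_mem_range_sleTrace_six {x y : ℝ} (hy : 0 < y) (hyx : y < x) :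
    preWienerMeasure.real {ω | ∃ r : ℝ, r ∈ Icc y x ∧ (r : ℂ) ∈ range (sleTrace 6 ω)} =
      1 - cardyFunction (y / x) := by
  haveI := isProbabilityMeasure_preWienerMeasure'
  have hx : 0 < x := hy.trans hyx
  have hT : HasSLETrace 6 := hasSLETrace_of_ne_eight_holds (by norm_num)
  have hxr := ae_ofReal_notMem_range_sleTrace (κ := 6) (x := x) (by norm_num) (by norm_num) hx.ne'
  set A : Set (ℝ≥0 → ℝ) :=
    {ω | swallowingTime (sleDriving 6 ω) y = swallowingTime (sleDriving 6 ω) x} with hA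
  have hAm : MeasurableSet A := measurableSet_sle_swallowingTime_eq 6 hx hy
  have hae : {ω | ∃ r : ℝ, r ∈ Icc y x ∧ (r : ℂ) ∈ range (sleTrace 6 ω)} =ᵐ[preWienerMeasure]
      (Aᶜ : Set _) := by
    rw [Filter.eventuallyEq_set]
    filter_upwards [hT, hxr] with ω hG hxω
    exact exists_mem_Icc_mem_range_iff (Loewner.isGeneratedByCurve_trace hG)
      (continuous_sleDriving 6 ω) (sleDriving_zero 6 ω) hy hyx.le hxω
  rw [measureReal_congr hae, measureReal_compl hAm, probReal_univ, hA,
    measureReal_swallowingTime_eq_six hy hyx]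

/-! ### The touch law for a negative segment -/

/-- Real points of the reflected path: `r ∈ -conj ∘ γ` iff `-r ∈ γ`. -/
theorem ofReal_mem_range_negConj_iff {γ : ℝ≥0 → ℂ} (r : ℝ) :
    (r : ℂ) ∈ range (fun t ↦ -conj (γ t)) ↔ ((-r : ℝ) : ℂ) ∈ range γ := by
  constructor
  · rintro ⟨t, ht⟩
    refine ⟨t, ?_⟩
    have := congrArg (fun z ↦ -conj z) ht
    simpa using this
  · rintro ⟨t, ht⟩
    refine ⟨t, ?_⟩
    simp only [ht, Complex.ofReal_neg, map_neg, Complex.conj_ofReal, neg_neg]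

/-- **Deterministic identification, mirror segment**: for a curve-generated chain with continuous
driving function from `0`, `0 < y ≤ x` and `-x` not visited, some real point of `[-x, -y]` is on the
curve iff `T_{-y} ≠ T_{-x}` (the reflected chain `-W` is generated by `-conj γ`,
`IsGeneratedByCurve.neg_conj`; `swallowingTime_neg_ofReal`). -/
theorem exists_mem_Icc_neg_mem_range_iff {W : ℝ≥0 → ℝ} {γ : ℝ≥0 → ℂ} (hγ : IsGeneratedByCurve W γ)
    (hW : Continuous W) (hW0 : W 0 = 0) {x y : ℝ} (hy : 0 < y) (hyx : y ≤ x)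
    (hx : ((-x : ℝ) : ℂ) ∉ range γ) :
    (∃ r : ℝ, r ∈ Icc (-x) (-y) ∧ (r : ℂ) ∈ range γ) ↔
      swallowingTime W ((-y : ℝ) : ℂ) ≠ swallowingTime W ((-x : ℝ) : ℂ) := by
  have h := exists_mem_Icc_mem_range_iff hγ.neg_conj hW.neg (by simp [hW0]) hy hyx
    (by rwa [ofReal_mem_range_negConj_iff])
  have e1 : swallowingTime (fun s ↦ -W s) (y : ℂ) = swallowingTime W ((-y : ℝ) : ℂ) := by
    simpa using swallowingTime_neg_ofReal W (-y)
  have e2 : swallowingTime (fun s ↦ -W s) (x : ℂ) = swallowingTime W ((-x : ℝ) : ℂ) := by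
    simpa using swallowingTime_neg_ofReal W (-x)
  rw [e1, e2] at h
  rw [← h]
  constructor
  · rintro ⟨r, hr, hmem⟩
    refine ⟨-r, ⟨by linarith [hr.2], by linarith [hr.1]⟩, ?_⟩
    rw [ofReal_mem_range_negConj_iff, neg_neg]
    exact hmem
  · rintro ⟨r, hr, hmem⟩
    refine ⟨-r, ⟨by linarith [hr.2], by linarith [hr.1]⟩, ?_⟩
    rw [ofReal_mem_range_negConj_iff] at hmem
    exact hmem

/-- **The SLE₆ touch law for a negative segment**: for `0 < y < x`, the SLE₆ trace meets the real
segment `[-x, -y]` with probability `1 - F(y/x)` (reflection of the positive case). -/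
theorem measureReal_exists_mem_Icc_neg_mem_range_sleTrace_six {x y : ℝ} (hy : 0 < y) (hyx : y < x) :
    preWienerMeasure.real {ω | ∃ r : ℝ, r ∈ Icc (-x) (-y) ∧ (r : ℂ) ∈ range (sleTrace 6 ω)} =
      1 - cardyFunction (y / x) := by
  haveI := isProbabilityMeasure_preWienerMeasure'
  have hx : 0 < x := hy.trans hyx
  have hT : HasSLETrace 6 := hasSLETrace_of_ne_eight_holds (by norm_num)
  have hxr := ae_ofReal_notMem_range_sleTrace (κ := 6) (x := -x) (by norm_num) (by norm_num)
    (neg_ne_zero.2 hx.ne')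
  set A : Set (ℝ≥0 → ℝ) := {ω | swallowingTime (sleDriving 6 ω) ((-y : ℝ) : ℂ) =
    swallowingTime (sleDriving 6 ω) ((-x : ℝ) : ℂ)} with hA
  have hAm : MeasurableSet A :=
    measurableSet_sle_swallowingTime_eq_of_neg 6 (neg_neg_of_pos hx) (neg_neg_of_pos hy)
  have hae : {ω | ∃ r : ℝ, r ∈ Icc (-x) (-y) ∧ (r : ℂ) ∈ range (sleTrace 6 ω)} =ᵐ[preWienerMeasure]
      (Aᶜ : Set _) := by
    rw [Filter.eventuallyEq_set]
    filter_upwards [hT, hxr] with ω hG hxω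
    exact exists_mem_Icc_neg_mem_range_iff (Loewner.isGeneratedByCurve_trace hG)
      (continuous_sleDriving 6 ω) (sleDriving_zero 6 ω) hy hyx.le hxω
  rw [measureReal_congr hae, measureReal_compl hAm, probReal_univ, hA,
    measureReal_swallowingTime_neg_eq 6 hx hy, measureReal_swallowingTime_eq_six hy hyx]

/-! ### Both sides at once -/

/-- For `u, v` of the same sign, `uIcc u v` is `[m, M]` or `[-M, -m]` with `m = min |u| |v|`,
`M = max |u| |v|`. -/
theorem uIcc_eq_of_same_sign {u v : ℝ} (huv : 0 < u * v) :
    (0 < u ∧ uIcc u v = Icc (min |u| |v|) (max |u| |v|)) ∨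
      (u < 0 ∧ uIcc u v = Icc (-max |u| |v|) (-min |u| |v|)) := by
  rcases lt_or_gt_of_ne (show u ≠ 0 from fun h ↦ by simp [h] at huv) with hu | hu
  · have hv : v < 0 := by nlinarith
    right
    refine ⟨hu, ?_⟩
    rw [abs_of_neg hu, abs_of_neg hv, uIcc, min_neg_neg, max_neg_neg, neg_neg, neg_neg]
  · have hv : 0 < v := by nlinarith
    left
    refine ⟨hu, ?_⟩
    rw [abs_of_pos hu, abs_of_pos hv, uIcc]

/-- **The SLE₆ touch law for a real segment off `0`** (registered helper of `stub_sleSideTouch`):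
for real `u ≠ v` of the same sign, the chordal SLE₆ trace in `(ℍ; 0, ∞)` meets the segment
`uIcc u v` with probability `1 - F(min |u| |v| / max |u| |v|)`, `F` Cardy's function
(Rohde–Schramm (2005), Lemma 6.6 at `κ = 6`, in Cardy's normalisation). -/
theorem sleSix_touch_uIcc :
    ∀ (u v : ℝ), 0 < u * v → u ≠ v → preWienerMeasure.real {ω | ∃ r : ℝ, r ∈ uIcc u v ∧ (r : ℂ) ∈ range (sleTrace 6 ω)} = 1 - cardyFunction (min |u| |v| / max |u| |v|) := by
  intro u v huv hne
  have hmin : 0 < min |u| |v| := lt_min (abs_pos.2 fun h ↦ by simp [h] at huv)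
    (abs_pos.2 fun h ↦ by simp [h] at huv)
  have hlt : min |u| |v| < max |u| |v| := by
    have habs : |u| ≠ |v| := by
      intro h
      rcases abs_eq_abs.1 h with h' | h'
      · exact hne h'
      · have : u * v = -(v * v) := by rw [h']; ring
        nlinarith [mul_self_nonneg v]
    rcases lt_or_gt_of_ne habs with h | h
    · rw [min_eq_left h.le, max_eq_right h.le]; exact h
    · rw [min_eq_right h.le, max_eq_left h.le]; exact h
  rcases uIcc_eq_of_same_sign huv with ⟨-, hI⟩ | ⟨-, hI⟩
  · simp only [hI]
    exact measureReal_exists_mem_Icc_mem_range_sleTrace_six hmin hlt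
  · simp only [hI]
    exact measureReal_exists_mem_Icc_neg_mem_range_sleTrace_six hmin hlt

end Summit.CriticalPhenomena.CardyFormulaZ2.Cruxes.SLESixFamiliesGiveCardy.CollarTouchSandwich
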